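import Summits.BirchSwinnertonDyer.BirchSwinnertonDyer.Theorems.KatoDescentPotSupersingularCartanMuRoadFukudaDoorsWild
import Literature.NumberTheory.IwasawaTheory.Fukuda1994Thm1Proofs
import HarnessLib

/-!
# The Cartan μ-road Fukuda doors at `p = 3` with Fukuda's Theorem 1 (1) DISCHARGED

Written by the prover seat `bsd-potss-k8t-c4` g19 (cell `bsd-potss`; supports stmt-BirchSwinnertonDyer-19982 (KT) and
stmt-BirchSwinnertonDyer-19197 (K9); closes nothing). The six `…_of_realSuccEqAt` doors of
`Theorems.CartanMuRoadFukudaDoorsTprime` (K8-t′, `SubTprime` rows) and `Theorems.CartanMuRoadFukudaDoorsWild` (K9, `ClassO6` rows)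
took Fukuda's Theorem 1 (1) as the named-fact hypothesis `hF1 : fukuda1994_thm1_classNumberPExp_const_of_succ_eq`; that fact is now
PROVED in the tree (`Literature/NumberTheory/IwasawaTheory/Fukuda1994Thm1Proofs.lean`,
`fukuda1994_thm1_classNumberPExp_const_of_succ_eq_holds`), so this file re-issues the six doors WITHOUT `hF1` (same names, namespace
`CartanMuRoadFukudaDoorsF1`). Every per-row record `conjA_g<label>_3_fukuda` / `missingUpperBoundAt_g<label>_3_fukuda` of the
`TameUpperFukudaQPRecords0k` files (16 FUKUDA1-STABLE rows) loses its `hF1` hypothesis by the same one-line application. The remaining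
named-fact hypotheses (`hCS` Coates–Sujatha Thm. 3.4, `hI` Iwasawa 1959, `hFW` Ferrero–Washington, and for the upper-bound doors
`hKatoA`, `hGZK`, `hmod`) are untouched. BSD is not advanced by this bookkeeping; it removes one conditional input from the K8-t′/K9
Fukuda records.
-/

set_option linter.dupNamespace false
set_option autoImplicit false

noncomputable section

open scoped Classical NumberField
open Field IntermediateField WeierstrassCurve IsDedekindDomain Polynomial
  Literature.NumberTheory.EllipticCurves Literature.NumberTheory.EllipticCurves.Rank1Residual
  Literature.NumberTheory.EllipticCurves.Rank1Residual.Typed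
  Literature.NumberTheory.GaloisRepresentations Literature.NumberTheory.SerreUniformity
  Literature.NumberTheory.IwasawaTheory
  Summit.BirchSwinnertonDyer.Rank1Residual Summit.BirchSwinnertonDyer.Rank1Residual.Additive
  Summit.BirchSwinnertonDyer.BirchSwinnertonDyer.Theorems.PrintX8TotallyRamified
  Summit.BirchSwinnertonDyer.BirchSwinnertonDyer.Theorems.AdditiveBranchIMCGordTwoRankOne

namespace Summit.BirchSwinnertonDyer.BirchSwinnertonDyer.Theorems.CartanMuRoadFukudaDoorsF1

/-- **(A) at `(W,3)` on a `3Ns` row from Fukuda Thm. 1 (1) at layers `(n, n+1)` of the cyclotomic `ℤ_3`-tower of `ℚ(P) = ℚ(W[3])^c`,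
`hram`-FREE** (modulo `hCS`, `hFW`, `hF1`): `W[3]` irreducible (`hirr`), image in `C_s⁺(3)` (`himg`), a complex conjugation `c`, and
`ord₃ h(ℚ(P)_{n+1}) = ord₃ h(ℚ(P)_n)` (`hord`); Fukuda's index `n₀ = 0` is §1 (`totallyRamifiedFrom_zero_intermediateField_divisionField`,
Serre Prop. 15 + §2). CONDITIONAL on the named facts; (A) asserted for no curve. [cite: Fukuda1994, Thm. 1 (1), p. 264]
[cite: CoatesSujatha2005, Thm. 3.4 (§3)] [cite: Serre1972, §2.4 Prop. 15, §5.2 (iv)] [cite: Washington1997, §13.1]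
UNCONDITIONAL IN FUKUDA: the hypothesis `hF1 : fukuda1994_thm1_classNumberPExp_const_of_succ_eq` of
`CartanMuRoadFukudaDoorsTprime.conjA_three_of_hasSplitCartanNormalizerModPImage_of_realSuccEqAt` is discharged by `fukuda1994_thm1_classNumberPExp_const_of_succ_eq_holds`. -/
theorem conjA_three_of_hasSplitCartanNormalizerModPImage_of_realSuccEqAt
    (W : WeierstrassCurve ℚ) [W.IsElliptic] (hCS : CoatesSujatha2005.thm34_fineSelmerDual_moduleFinite_of_classicalMuVanishes_divisionField)
    (hFW : ferreroWashington1979_classicalMuVanishes)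
    (hirr : W.HasIrreducibleModPGaloisRep 3) (himg : HasSplitCartanNormalizerModPImage W 3)
    {c : absoluteGaloisGroup ℚ} (hc : IsComplexConjugation (Rat.castHom ℝ) c) (n : ℕ)
    (hord : ∀ κE : ZpExtension ↥(fixedField (Subgroup.zpowers (absRestrictNormalHom (W.divisionField 3) c))) 3,
      κE.IsCyclotomic → classNumberPExp κE (n + 1) = classNumberPExp κE n)
    (κ : ZpExtension ℚ 3) (hκ : κ.IsCyclotomic) :
    ∃ (γ : absoluteGaloisGroup ℚ) (D : W.FineSelmerDualData κ γ),
      Module.Finite ℤ_[3] (RestrictScalars ℤ_[3] (IwasawaAlgebra 3) D.X) := by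
  apply CartanMuRoadFukudaDoorsTprime.conjA_three_of_hasSplitCartanNormalizerModPImage_of_realSuccEqAt <;>
    first
    | exact Literature.NumberTheory.IwasawaTheory.fukuda1994_thm1_classNumberPExp_const_of_succ_eq_holds
    | assumption

/-- **(A) at `(W,3)` on a `3Nn` row from Fukuda Thm. 1 (1) at layers `(n, n+1)` of the tower of `ℚ(P) = ℚ(W[3])^c` (degree `8`),
`hram`-FREE, paying Iwasawa's growth theorem `hI`** (modulo `hCS`, `hI`, `hFW`, `hF1`): image EQUAL to `C_ns⁺(3)` (`himg`), `W[3]`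
irreducible (`hirr`), a complex conjugation `c`, `ord₃ h(ℚ(P)_{n+1}) = ord₃ h(ℚ(P)_n)` (`hord`). The door for the 19 KT `3Nn` U₀-ns rows
graded FUKUDA-L(0,1) (`e₀ = e₁ = 2`). CONDITIONAL. [cite: Fukuda1994, Thm. 1 (1), p. 264] [cite: CoatesSujatha2005, Thm. 3.4 (§3)]
[cite: Serre1972, §2.4 Prop. 15, §5.2 (iv)] [cite: Washington1997, §13.1]
UNCONDITIONAL IN FUKUDA: the hypothesis `hF1 : fukuda1994_thm1_classNumberPExp_const_of_succ_eq` of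
`CartanMuRoadFukudaDoorsTprime.conjA_three_of_hasModPImageEqNonsplitCartanNormalizer_of_realSuccEqAt'` is discharged by `fukuda1994_thm1_classNumberPExp_const_of_succ_eq_holds`. -/
theorem conjA_three_of_hasModPImageEqNonsplitCartanNormalizer_of_realSuccEqAt'
    (W : WeierstrassCurve ℚ) [W.IsElliptic] (hCS : CoatesSujatha2005.thm34_fineSelmerDual_moduleFinite_of_classicalMuVanishes_divisionField)
    (hI : iwasawa1959_classNumberPExp_growth) (hFW : ferreroWashington1979_classicalMuVanishes)
   
    (hirr : W.HasIrreducibleModPGaloisRep 3) (himg : HasModPImageEqNonsplitCartanNormalizer W 3)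
    {c : absoluteGaloisGroup ℚ} (hc : IsComplexConjugation (Rat.castHom ℝ) c) (n : ℕ)
    (hord : ∀ κE : ZpExtension ↥(fixedField (Subgroup.zpowers (absRestrictNormalHom (W.divisionField 3) c))) 3,
      κE.IsCyclotomic → classNumberPExp κE (n + 1) = classNumberPExp κE n)
    (κ : ZpExtension ℚ 3) (hκ : κ.IsCyclotomic) :
    ∃ (γ : absoluteGaloisGroup ℚ) (D : W.FineSelmerDualData κ γ),
      Module.Finite ℤ_[3] (RestrictScalars ℤ_[3] (IwasawaAlgebra 3) D.X) := by
  apply CartanMuRoadFukudaDoorsTprime.conjA_three_of_hasModPImageEqNonsplitCartanNormalizer_of_realSuccEqAt' <;>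
    first
    | exact Literature.NumberTheory.IwasawaTheory.fukuda1994_thm1_classNumberPExp_const_of_succ_eq_holds
    | assumption

/-- **U₀ at a `3Ns` (t′) row from Fukuda Thm. 1 (1) on `ℚ(P)`, `hram`-FREE**: `ord₃ #Ш(W) ≤ ord₃ #Ш_an(W)` (`MissingUpperBoundAt W 3`)
for a rank-`0` (t′) row (`Addv W 3`, `SubTprime W 3`) with `W[3]` irreducible and image in `C_s⁺(3)`, from the named facts
`hKatoA hGZK hmod hCS hFW hF1`, a complex conjugation `c` and ONE integer equality `ord₃ h(ℚ(P)_{n+1}) = ord₃ h(ℚ(P)_n)`.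
CONDITIONAL; nothing booked; BSD for no curve. [cite: Kato2004Asterisque, Thm. 14.5 (3) (p. 236), Thm. 12.5 (3) (p. 222)]
[cite: Fukuda1994, Thm. 1 (1), p. 264] [cite: CoatesSujatha2005, Thm. 3.4 (§3)] [cite: Serre1972, §2.4 Prop. 15, §5.2 (iv)]
UNCONDITIONAL IN FUKUDA: the hypothesis `hF1 : fukuda1994_thm1_classNumberPExp_const_of_succ_eq` of
`CartanMuRoadFukudaDoorsTprime.missingUpperBoundAt_three_tame_of_hasSplitCartanNormalizerModPImage_of_realSuccEqAt` is discharged by `fukuda1994_thm1_classNumberPExp_const_of_succ_eq_holds`. -/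
theorem missingUpperBoundAt_three_tame_of_hasSplitCartanNormalizerModPImage_of_realSuccEqAt
    (W : WeierstrassCurve ℚ) [W.IsElliptic] [W.IsGloballyMinimal] (hKatoA : Kato2004.rankZero_padicValNat_sha_add_padicValNat_tamagawa_le_of_additive_potGood_of_irreducible_of_fineSelmerDual_fg)
    (hGZK : rank_eq_analyticRank_of_analyticRank_le_one) (hmod : hasEntireLFunction_rat)
    (hCS : CoatesSujatha2005.thm34_fineSelmerDual_moduleFinite_of_classicalMuVanishes_divisionField)
    (hFW : ferreroWashington1979_classicalMuVanishes)
    [Fact (3 : ℕ).Prime] (hr : W.analyticRank = 0) (hadd : Addv W 3) (hT : SubTprime W 3)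
    (hirr : W.HasIrreducibleModPGaloisRep 3) (himg : HasSplitCartanNormalizerModPImage W 3)
    {c : absoluteGaloisGroup ℚ} (hc : IsComplexConjugation (Rat.castHom ℝ) c) (n : ℕ)
    (hord : ∀ κE : ZpExtension ↥(fixedField (Subgroup.zpowers (absRestrictNormalHom (W.divisionField 3) c))) 3,
      κE.IsCyclotomic → classNumberPExp κE (n + 1) = classNumberPExp κE n) :
    MissingUpperBoundAt W 3 := by
  apply CartanMuRoadFukudaDoorsTprime.missingUpperBoundAt_three_tame_of_hasSplitCartanNormalizerModPImage_of_realSuccEqAt <;>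
    first
    | exact Literature.NumberTheory.IwasawaTheory.fukuda1994_thm1_classNumberPExp_const_of_succ_eq_holds
    | assumption

/-- **U₀ at a `3Nn` (t′) row from Fukuda Thm. 1 (1) on `ℚ(P)` (degree `8`), `hram`-FREE, paying `hI`**: `MissingUpperBoundAt W 3` for a
rank-`0` (t′) row with `W[3]` irreducible and image EQUAL to `C_ns⁺(3)`, from the named facts `hKatoA hGZK hmod hCS hI hFW hF1`, a complex
conjugation `c` and ONE integer equality `ord₃ h(ℚ(P)_{n+1}) = ord₃ h(ℚ(P)_n)` — the per-row door of the 19 KT FUKUDA-L(0,1) `3Nn` rows.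
CONDITIONAL; nothing booked; BSD for no curve. [cite: Kato2004Asterisque, Thm. 14.5 (3) (p. 236), Thm. 12.5 (3) (p. 222)]
[cite: Fukuda1994, Thm. 1 (1), p. 264] [cite: CoatesSujatha2005, Thm. 3.4 (§3)] [cite: Serre1972, §2.4 Prop. 15, §5.2 (iv)]
[cite: Washington1997, §13.1]
UNCONDITIONAL IN FUKUDA: the hypothesis `hF1 : fukuda1994_thm1_classNumberPExp_const_of_succ_eq` of
`CartanMuRoadFukudaDoorsTprime.missingUpperBoundAt_three_tame_of_hasModPImageEqNonsplitCartanNormalizer_of_realSuccEqAt'` is discharged by `fukuda1994_thm1_classNumberPExp_const_of_succ_eq_holds`. -/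
theorem missingUpperBoundAt_three_tame_of_hasModPImageEqNonsplitCartanNormalizer_of_realSuccEqAt'
    (W : WeierstrassCurve ℚ) [W.IsElliptic] [W.IsGloballyMinimal] (hKatoA : Kato2004.rankZero_padicValNat_sha_add_padicValNat_tamagawa_le_of_additive_potGood_of_irreducible_of_fineSelmerDual_fg)
    (hGZK : rank_eq_analyticRank_of_analyticRank_le_one) (hmod : hasEntireLFunction_rat)
    (hCS : CoatesSujatha2005.thm34_fineSelmerDual_moduleFinite_of_classicalMuVanishes_divisionField)
    (hI : iwasawa1959_classNumberPExp_growth) (hFW : ferreroWashington1979_classicalMuVanishes)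
   
    [Fact (3 : ℕ).Prime] (hr : W.analyticRank = 0) (hadd : Addv W 3) (hT : SubTprime W 3)
    (hirr : W.HasIrreducibleModPGaloisRep 3) (himg : HasModPImageEqNonsplitCartanNormalizer W 3)
    {c : absoluteGaloisGroup ℚ} (hc : IsComplexConjugation (Rat.castHom ℝ) c) (n : ℕ)
    (hord : ∀ κE : ZpExtension ↥(fixedField (Subgroup.zpowers (absRestrictNormalHom (W.divisionField 3) c))) 3,
      κE.IsCyclotomic → classNumberPExp κE (n + 1) = classNumberPExp κE n) :
    MissingUpperBoundAt W 3 := by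
  apply CartanMuRoadFukudaDoorsTprime.missingUpperBoundAt_three_tame_of_hasModPImageEqNonsplitCartanNormalizer_of_realSuccEqAt' <;>
    first
    | exact Literature.NumberTheory.IwasawaTheory.fukuda1994_thm1_classNumberPExp_const_of_succ_eq_holds
    | assumption

/-- **U₀ at a `3Ns` O6 row from Fukuda Thm. 1 (1) on `ℚ(P)` at layers `(n, n+1)`, `hram`-FREE**: `ord₃ #Ш(W) ≤ ord₃ #Ш_an(W)`
(`MissingUpperBoundAt W 3`) for a rank-`0` row of `ClassO6 W 3` with `W[3]` irreducible and image in `C_s⁺(3)`, from the named facts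
`hKatoA hGZK hmod hCS hFW hF1`, a complex conjugation `c` and ONE integer equality `ord₃ h(ℚ(P)_{n+1}) = ord₃ h(ℚ(P)_n)` (`hord`).
CONDITIONAL; nothing booked; BSD for no curve. [cite: Kato2004Asterisque, Thm. 14.5 (3) (p. 236)] [cite: Fukuda1994, Thm. 1 (1), p. 264]
[cite: CoatesSujatha2005, Thm. 3.4 (§3)] [cite: Serre1972, §2.4 Prop. 15, §5.2 (iv)]
UNCONDITIONAL IN FUKUDA: the hypothesis `hF1 : fukuda1994_thm1_classNumberPExp_const_of_succ_eq` of
`CartanMuRoadFukudaDoorsWild.missingUpperBoundAt_three_of_hasSplitCartanNormalizerModPImage_of_realSuccEqAt` is discharged by `fukuda1994_thm1_classNumberPExp_const_of_succ_eq_holds`. -/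
theorem missingUpperBoundAt_three_of_hasSplitCartanNormalizerModPImage_of_realSuccEqAt
    (W : WeierstrassCurve ℚ) [W.IsElliptic] [W.IsGloballyMinimal] (hKatoA : Kato2004.rankZero_padicValNat_sha_add_padicValNat_tamagawa_le_of_additive_potGood_of_irreducible_of_fineSelmerDual_fg)
    (hGZK : rank_eq_analyticRank_of_analyticRank_le_one) (hmod : hasEntireLFunction_rat)
    (hCS : CoatesSujatha2005.thm34_fineSelmerDual_moduleFinite_of_classicalMuVanishes_divisionField)
    (hFW : ferreroWashington1979_classicalMuVanishes)
    [Fact (3 : ℕ).Prime] (hr : W.analyticRank = 0) (hO : ClassO6 W 3) (hirr : W.HasIrreducibleModPGaloisRep 3)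
    (himg : HasSplitCartanNormalizerModPImage W 3) {c : absoluteGaloisGroup ℚ} (hc : IsComplexConjugation (Rat.castHom ℝ) c)
    (n : ℕ)
    (hord : ∀ κE : ZpExtension ↥(fixedField (Subgroup.zpowers (absRestrictNormalHom (W.divisionField 3) c))) 3,
      κE.IsCyclotomic → classNumberPExp κE (n + 1) = classNumberPExp κE n) :
    MissingUpperBoundAt W 3 := by
  apply CartanMuRoadFukudaDoorsWild.missingUpperBoundAt_three_of_hasSplitCartanNormalizerModPImage_of_realSuccEqAt <;>
    first
    | exact Literature.NumberTheory.IwasawaTheory.fukuda1994_thm1_classNumberPExp_const_of_succ_eq_holds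
    | assumption

/-- **U₀ at a `3Nn` O6 row from Fukuda Thm. 1 (1) on `ℚ(P)` (degree `8`) at layers `(n, n+1)`, `hram`-FREE, paying `hI`** (named facts
`hKatoA hGZK hmod hCS hI hFW hF1`; image EQUAL to `C_ns⁺(3)`; `ord₃ h(ℚ(P)_{n+1}) = ord₃ h(ℚ(P)_n)`). CONDITIONAL; nothing booked; BSD
for no curve. [cite: Kato2004Asterisque, Thm. 14.5 (3) (p. 236)] [cite: Fukuda1994, Thm. 1 (1), p. 264] [cite: CoatesSujatha2005, Thm. 3.4 (§3)]
[cite: Serre1972, §2.4 Prop. 15, §5.2 (iv)] [cite: Washington1997, §13.1]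
UNCONDITIONAL IN FUKUDA: the hypothesis `hF1 : fukuda1994_thm1_classNumberPExp_const_of_succ_eq` of
`CartanMuRoadFukudaDoorsWild.missingUpperBoundAt_three_of_hasModPImageEqNonsplitCartanNormalizer_of_realSuccEqAt'` is discharged by `fukuda1994_thm1_classNumberPExp_const_of_succ_eq_holds`. -/
theorem missingUpperBoundAt_three_of_hasModPImageEqNonsplitCartanNormalizer_of_realSuccEqAt'
    (W : WeierstrassCurve ℚ) [W.IsElliptic] [W.IsGloballyMinimal] (hKatoA : Kato2004.rankZero_padicValNat_sha_add_padicValNat_tamagawa_le_of_additive_potGood_of_irreducible_of_fineSelmerDual_fg)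
    (hGZK : rank_eq_analyticRank_of_analyticRank_le_one) (hmod : hasEntireLFunction_rat)
    (hCS : CoatesSujatha2005.thm34_fineSelmerDual_moduleFinite_of_classicalMuVanishes_divisionField)
    (hI : iwasawa1959_classNumberPExp_growth) (hFW : ferreroWashington1979_classicalMuVanishes)
   
    [Fact (3 : ℕ).Prime] (hr : W.analyticRank = 0) (hO : ClassO6 W 3) (hirr : W.HasIrreducibleModPGaloisRep 3)
    (himg : HasModPImageEqNonsplitCartanNormalizer W 3) {c : absoluteGaloisGroup ℚ}
    (hc : IsComplexConjugation (Rat.castHom ℝ) c) (n : ℕ)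
    (hord : ∀ κE : ZpExtension ↥(fixedField (Subgroup.zpowers (absRestrictNormalHom (W.divisionField 3) c))) 3,
      κE.IsCyclotomic → classNumberPExp κE (n + 1) = classNumberPExp κE n) :
    MissingUpperBoundAt W 3 := by
  apply CartanMuRoadFukudaDoorsWild.missingUpperBoundAt_three_of_hasModPImageEqNonsplitCartanNormalizer_of_realSuccEqAt' <;>
    first
    | exact Literature.NumberTheory.IwasawaTheory.fukuda1994_thm1_classNumberPExp_const_of_succ_eq_holds
    | assumption

end Summit.BirchSwinnertonDyer.BirchSwinnertonDyer.Theorems.CartanMuRoadFukudaDoorsF1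

end
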